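import Mathlib
import HarnessLib
import Summits.HubbardSuperconductivity.HubbardSuperconductivity.Theorems.KLProgrammeKLRegimeEngineV8E5BlockLabels
import Summits.HubbardSuperconductivity.HubbardSuperconductivity.Theorems.KLProgrammeKLRegimeSectorGramSoftShapedSharp

/-!
# Route `KLProgramme` — ENGINE child gen 8 (stmt-HubbardSuperconductivity-20437 `KLRegimeEngineV17F2`), skeleton v2 class #3 witness input GAP L2:
# the DRESSED soft line `klE5SoftLineSym` of p5's E.5 block is soft-shaped (`‖·‖ ≤ 8·βL²/ρ_K`), hence its β-UNIFORM line data on the fat family BY NAME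
# (cell gate-hubbard-kl, seat hubbard-kl-k3c2-p2 g9, value/(T) lane; the literal `hent` / `hκF` / `hκG` of `klE5_tail_le_of_lineData_pointAugment` for `s₁`)

* §1 `norm_oneSubWeight_symbol_le_div_radius` (`‖(1 − w^K_Λ′)·βL²(iω+e_K)/den‖ ≤ βL²/ρ_K`), `norm_klE5SliceSym_le_div_radius` (`‖s_Λ‖ ≤ βL²/ρ_K`),
  **`norm_klE5SoftLineSym_le_div_radius`** — under the dressing smallness `‖s_{Λ_{n₀+1}}κ‖, ‖s_Λκ‖ ≤ ½` at `ks`: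
  `‖klE5SoftLineSym … n₀ κ Λ ks‖ ≤ 8·βL²/√(ω² + e_K²)` (`norm_klE5SoftLineSym_le`: `4‖A‖ + 2‖s₁‖ + 2‖s_Λ‖`);
* §2 **`gram_klE5SoftLine_bgmFat_sharp_klEng`** — `∃ Cκ > 0`: under EXACTLY the stub binders, for the fat family of index `1 ≤ n ≤ nScales β + 1`, every
  `n₀`, dressing `κ` and cutoff `Λ` with the smallness at every label: the line `S(Ft_n)ᵀ·normalCovariance (klE5SoftLineSym … n₀ κ Λ)·S(Ft_n)` has
  entries `≤ 8·Cκ·e₀·8^{-n}`, `IsGramBoundedR … √(8·Cκ·e₀·8^{-n})`, and Gram half-norms `≤ √(8·Cκ·e₀·8^{-n})` — β-UNIFORM, no `Λ_n/Λ_{n_β+1}`, no relation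
  between `n` and `n₀` needed (`gram_softShaped_bgmFat_sharp_klEng` at `A_p = 8`).

Pure composition; no definitions, no named facts; nothing about sizes of the model is asserted; nothing asserts superconductivity.
-/

noncomputable section

namespace Summit.HubbardSuperconductivity.HubbardSuperconductivity.Theorems.KLRegimeSplit

set_option linter.dupNamespace false -- summit = problem name (single-conjunct summit), D-0017

open Real Finset Literature.MathematicalPhysics.QuantumLattice Literature.Probability.LatticeModels
open Summit.HubbardSuperconductivity.HubbardSuperconductivity.Theorems.KLProgrammeLegKernels
open Summit.HubbardSuperconductivity.HubbardSuperconductivity.Theorems.EngineV8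
open Summit.HubbardSuperconductivity.HubbardSuperconductivity.Theorems.KLRegimeWick
open Summit.HubbardSuperconductivity.HubbardSuperconductivity.Theorems.TorusFourierL2

/-! ## §1 The dressed soft line is soft-shaped -/

section Shape

variable {L M : ℕ} (β μ : ℝ) (K : TrigPolyC4v) (n₀ : ℕ) (κ : FreqMomentum L M × Fin 2 → ℂ)

/-- `‖(1 − w^K_{Λ′}(ks))·βL²·(iω + e_K)/den_K‖ ≤ βL²/√(ω² + e_K²)` (`0 ≤ β`; the weight is in `[0,1]`). -/
theorem norm_oneSubWeight_symbol_le_div_radius (hβ : 0 ≤ β) (Λ' : ℝ) (ks : FreqMomentum L M × Fin 2) :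
    ‖(1 - (hubbardCutoffWeightCT L M β μ K Λ' ks.1 : ℂ)) *
        (((β * (L : ℝ) ^ 2 : ℝ) : ℂ) * ((Complex.I * matsubaraFreq β M ks.1.1 + nambuXiCT L μ K ks.1.2) / nambuDenCT L M β μ 0 K ks.1))‖ ≤
      β * (L : ℝ) ^ 2 / Real.sqrt (matsubaraFreq β M ks.1.1 ^ 2 + nambuXiCT L μ K ks.1.2 ^ 2) := by
  set ω : ℝ := matsubaraFreq β M ks.1.1 with hω
  set ξ : ℝ := nambuXiCT L μ K ks.1.2 with hξ
  have hw : ‖(1 - (hubbardCutoffWeightCT L M β μ K Λ' ks.1 : ℂ))‖ ≤ 1 := by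
    have hmem : hubbardCutoffWeightCT L M β μ K Λ' ks.1 ∈ Set.Icc (0 : ℝ) 1 := by
      unfold hubbardCutoffWeightCT; exact salmhoferCutoff_mem_Icc _
    rw [show (1 - (hubbardCutoffWeightCT L M β μ K Λ' ks.1 : ℂ)) = ((1 - hubbardCutoffWeightCT L M β μ K Λ' ks.1 : ℝ) : ℂ) by push_cast; ring,
      Complex.norm_real, Real.norm_eq_abs, abs_le]
    constructor <;> linarith [hmem.1, hmem.2]
  have hden : (nambuDenCT L M β μ 0 K ks.1 : ℝ) = ω ^ 2 + ξ ^ 2 := by rw [nambuDenCT_zero_seed]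
  have hsym : ‖(Complex.I * (ω : ℂ) + (ξ : ℂ)) / ((nambuDenCT L M β μ 0 K ks.1 : ℝ) : ℂ)‖ = 1 / Real.sqrt (ω ^ 2 + ξ ^ 2) := by
    rw [hden]; exact norm_I_mul_add_div' ω ξ
  have hβL : ‖(((β * (L : ℝ) ^ 2 : ℝ)) : ℂ)‖ = β * (L : ℝ) ^ 2 := by
    rw [Complex.norm_real, Real.norm_eq_abs, abs_of_nonneg (by positivity)]
  have hs0 : 0 ≤ 1 / Real.sqrt (ω ^ 2 + ξ ^ 2) := by positivity
  calc ‖(1 - (hubbardCutoffWeightCT L M β μ K Λ' ks.1 : ℂ)) *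
          (((β * (L : ℝ) ^ 2 : ℝ) : ℂ) * ((Complex.I * (ω : ℂ) + (ξ : ℂ)) / ((nambuDenCT L M β μ 0 K ks.1 : ℝ) : ℂ)))‖
      = ‖(1 - (hubbardCutoffWeightCT L M β μ K Λ' ks.1 : ℂ))‖ * ((β * (L : ℝ) ^ 2) * (1 / Real.sqrt (ω ^ 2 + ξ ^ 2))) := by
        rw [norm_mul, norm_mul, hβL, hsym]
    _ ≤ 1 * ((β * (L : ℝ) ^ 2) * (1 / Real.sqrt (ω ^ 2 + ξ ^ 2))) :=
        mul_le_mul_of_nonneg_right hw (mul_nonneg (by positivity) hs0)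
    _ = β * (L : ℝ) ^ 2 / Real.sqrt (ω ^ 2 + ξ ^ 2) := by ring

/-- **The partial-slice symbol is soft-shaped**: `‖klE5SliceSym … n₀ Λ ks‖ ≤ βL²/√(ω² + e_K²)` (`0 ≤ β`). -/
theorem norm_klE5SliceSym_le_div_radius (hβ : 0 ≤ β) (Λ : ℝ) (ks : FreqMomentum L M × Fin 2) :
    ‖klE5SliceSym L M β μ K n₀ Λ ks‖ ≤ β * (L : ℝ) ^ 2 / Real.sqrt (matsubaraFreq β M ks.1.1 ^ 2 + nambuXiCT L μ K ks.1.2 ^ 2) := by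
  unfold klE5SliceSym
  exact norm_sliceSymbolCT_le_div_radius hβ μ K Λ (klScale klE0 n₀) ks

/-- **The dressed soft line is soft-shaped**: under the dressing smallness `‖s_{Λ_{n₀+1}}(ks)κ(ks)‖ ≤ ½`, `‖s_Λ(ks)κ(ks)‖ ≤ ½`,
`‖klE5SoftLineSym … n₀ κ Λ ks‖ ≤ 8·βL²/√(ω² + e_K²)` (`0 ≤ β`). -/
theorem norm_klE5SoftLineSym_le_div_radius (hβ : 0 ≤ β) {Λ : ℝ} (ks : FreqMomentum L M × Fin 2)
    (h1 : ‖klE5SliceSym L M β μ K n₀ (klScale klE0 (n₀ + 1)) ks * κ ks‖ ≤ 1 / 2) (hΛ : ‖klE5SliceSym L M β μ K n₀ Λ ks * κ ks‖ ≤ 1 / 2) :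
    ‖klE5SoftLineSym L M β μ K n₀ κ Λ ks‖ ≤ 8 * (β * (L : ℝ) ^ 2) / Real.sqrt (matsubaraFreq β M ks.1.1 ^ 2 + nambuXiCT L μ K ks.1.2 ^ 2) := by
  have h := norm_klE5SoftLineSym_le β μ K n₀ κ ks h1 hΛ
  have hA := norm_oneSubWeight_symbol_le_div_radius (L := L) (M := M) β μ K hβ (klScale klE0 (n₀ + 1)) ks
  have hs1 := norm_klE5SliceSym_le_div_radius (L := L) (M := M) β μ K n₀ hβ (klScale klE0 (n₀ + 1)) ks
  have hsΛ := norm_klE5SliceSym_le_div_radius (L := L) (M := M) β μ K n₀ hβ Λ ks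
  have e : 8 * (β * (L : ℝ) ^ 2) / Real.sqrt (matsubaraFreq β M ks.1.1 ^ 2 + nambuXiCT L μ K ks.1.2 ^ 2) =
      4 * (β * (L : ℝ) ^ 2 / Real.sqrt (matsubaraFreq β M ks.1.1 ^ 2 + nambuXiCT L μ K ks.1.2 ^ 2)) +
        2 * (β * (L : ℝ) ^ 2 / Real.sqrt (matsubaraFreq β M ks.1.1 ^ 2 + nambuXiCT L μ K ks.1.2 ^ 2)) +
          2 * (β * (L : ℝ) ^ 2 / Real.sqrt (matsubaraFreq β M ks.1.1 ^ 2 + nambuXiCT L μ K ks.1.2 ^ 2)) := by ring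
  rw [e]
  linarith

end Shape

/-! ## §2 The β-uniform line data of the dressed soft line on the fat family, under the stub binders -/

/-- **β-UNIFORM line data of p5's DRESSED soft line on the fat family, BY NAME** (the literal `hent` / `hκF` / `hκG` for the symbol `s₁ = klE5SoftLineSym`
of `klE5_tail_le_of_lineData_pointAugment`): there is an absolute `Cκ > 0` such that under EXACTLY the stub binders, for the fat family
`Ft_n = bgmFatMultiplier … klE0 … n` (`1 ≤ n ≤ nScales β + 1`), every step index `n₀`, dressing `κ` and cutoff `Λ` with the dressing smallness
`‖s_{Λ_{n₀+1}}κ‖ ≤ ½`, `‖s_Λκ‖ ≤ ½` at every label: entries of `S(Ft_n)ᵀ·normalCovariance (klE5SoftLineSym … n₀ κ Λ)·S(Ft_n)` are `≤ 8·Cκ·e₀·8^{-n}`, the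
line is replica-Gram-bounded by `√(8·Cκ·e₀·8^{-n})`, and both Gram half-norms are `≤ √(8·Cκ·e₀·8^{-n})` — no `Λ_n/Λ_{n_β+1}`, no relation between `n` and `n₀`.
[cite: BenfattoGiulianiMastropietro2006, §2.8 (2.80)] -/
theorem gram_klE5SoftLine_bgmFat_sharp_klEng :
    ∃ Cκ : ℝ, 0 < Cκ ∧ ∀ (P : SplitConsts) (R : RenConsts) (c : ℝ), P.WF → R.WF2 → 0 < c → c ≤ klEngC₃3 P R →
      ∀ μ ∈ klWindowC, ∀ U : ℝ, 0 < U → U ≤ klEngU₀4 P R c → ∀ β : ℝ, klBetaMin ≤ β → β ≤ Real.exp (c / U ^ 2) →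
      ∀ K : TrigPolyC4v, FrameOK R U (nScales β) μ K → ∀ (L M : ℕ) [NeZero L] [NeZero M],
      klEngL₃ β U ≤ L → klEngM₃ β U L ≤ M → ∀ n : ℕ, 1 ≤ n → n ≤ nScales β + 1 →
      ∀ (n₀ : ℕ) (κ : FreqMomentum L M × Fin 2 → ℂ) (Λ : ℝ),
      (∀ ks : FreqMomentum L M × Fin 2, ‖klE5SliceSym L M β μ K n₀ (klScale klE0 (n₀ + 1)) ks * κ ks‖ ≤ 1 / 2 ∧
          ‖klE5SliceSym L M β μ K n₀ Λ ks * κ ks‖ ≤ 1 / 2) →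
        (∀ Y Y' : SpaceTimeIdx L M × SectorLeg (sectorCount n),
          ‖((sectorSubMatrix L M β (bgmFatMultiplier L M klE0 β (nambuXiCT L μ K) n)).transpose *
              normalCovariance L M (klE5SoftLineSym L M β μ K n₀ κ Λ) * sectorSubMatrix L M β (bgmFatMultiplier L M klE0 β (nambuXiCT L μ K) n)) Y Y'‖ ≤
            8 * Cκ * (klE0 * ((8 : ℝ) ^ n)⁻¹)) ∧
        IsGramBoundedR ((sectorSubMatrix L M β (bgmFatMultiplier L M klE0 β (nambuXiCT L μ K) n)).transpose *
              normalCovariance L M (klE5SoftLineSym L M β μ K n₀ κ Λ) * sectorSubMatrix L M β (bgmFatMultiplier L M klE0 β (nambuXiCT L μ K) n))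
          (Real.sqrt (8 * Cκ * (klE0 * ((8 : ℝ) ^ n)⁻¹))) ∧
        (∀ Y : SpaceTimeIdx L M × SectorLeg (sectorCount n),
          ‖sectorGramF L M β (bgmFatMultiplier L M klE0 β (nambuXiCT L μ K) n) (klE5SoftLineSym L M β μ K n₀ κ Λ) Y‖ ≤
            Real.sqrt (8 * Cκ * (klE0 * ((8 : ℝ) ^ n)⁻¹))) ∧
        (∀ Y' : SpaceTimeIdx L M × SectorLeg (sectorCount n),
          ‖sectorGramG L M β (bgmFatMultiplier L M klE0 β (nambuXiCT L μ K) n) (klE5SoftLineSym L M β μ K n₀ κ Λ) Y'‖ ≤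
            Real.sqrt (8 * Cκ * (klE0 * ((8 : ℝ) ^ n)⁻¹))) := by
  obtain ⟨Cκ, hCκ, h⟩ := gram_softShaped_bgmFat_sharp_klEng
  refine ⟨Cκ, hCκ, ?_⟩
  intro P R c hP hR2 hc hc3 μ hμ U hU hU0 β hβmin hβc K hK L M _ _ hL3 hM3 n hn hnN n₀ κ Λ hsmall
  have hβ : 0 ≤ β := (pos_of_klBetaMin_le hβmin).le
  exact h P R c hP hR2 hc hc3 μ hμ U hU hU0 β hβmin hβc K hK L M hL3 hM3 n hn hnN (klE5SoftLineSym L M β μ K n₀ κ Λ) 8 (by norm_num)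
    fun ks _ => norm_klE5SoftLineSym_le_div_radius (L := L) (M := M) β μ K n₀ κ hβ ks (hsmall ks).1 (hsmall ks).2

end Summit.HubbardSuperconductivity.HubbardSuperconductivity.Theorems.KLRegimeSplit

end
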